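import Summits.AtomisticToContinuum.BoseEinsteinCondensation.Theorems.BECInsertionCorrectorStaticResponseBoundUvComposition
import HarnessLib

/-!
# The few-body half of the static response bound, IV: the crux is its large-`N`, WEAK-COUPLING content
# (line `stable-fraction-square-completion`, seat c2 layer; item stmt-AtomisticToContinuum-12057 — this file supports,
# does not close, the item)

The many-body half `LargeNHalf` of the seat-c2 skeleton (the crux restricted to `N⁸ρa³ > c`, every `c > 0`) asks the
crux's inequality for EVERY coupling `t`.  Here we show that only the LINEAR-RESPONSE WINDOW

  `t² ≤ ε² · ρa · max(ρa, |p|²)`        (any fixed `ε > 0`; relative density modulation `≲ ε`)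

carries content: outside it the inequality follows from the two trivial mechanisms already in the tree —
* infrared branch (`|p|² ≤ ρa`): `|t| > ερa` and the floor `t⟨∑cos⟩ ≥ −|t|N` (`ineq_of_large_t`, `C ≥ 1/ε`);
* ultraviolet branch (`ρa ≤ |p|²`): `t² > ε²ρa|p|²`, the free completed square `−Nt²/|p|² ≤ E + t⟨∑cos⟩`
  (`stub_freeSquare`, p73757) and the dilute upper bound `E₀ ≤ KρaN` (`N ≥ 2`; `E₀ = 0` for `N = 1`), `C ≥ 1 + K/ε²`.
Hence (`largeNHalf_of_coreWeak`, binder form `largeNHalf_of_coreWeak'`) `LargeNHalf ⟸ CoreWeak ε` for every `ε > 0`, where `CoreWeak ε` is the crux restricted to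
`N⁸ρa³ > c` AND `t² ≤ ε²ρa·max(ρa,|p|²)`; with parts I–III (`staticResponseBound_iff_largeNHalf`) the crux is therefore
EQUIVALENT (modulo the classical `MaxFormBound`) to its large-`N`, weak-coupling content — the BathMassLiouville planner's
foreseen "∀ᶠN, |t| ≤ t₀ρa version", made precise, loses nothing.  The dilute upper bound is taken as a hypothesis (it is
proved in the `FewBodyWindow` file of the layer, `exists_groundStateEnergy_toReal_le`, from `LSSY2005_upperBound_periodic_holds`).
-/

noncomputable section

namespace Summit.AtomisticToContinuum.BoseEinsteinCondensation.Cruxes.StaticResponseBound.FewBody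

open MeasureTheory Filter
open scoped ENNReal NNReal BigOperators Topology
open Literature.MathematicalPhysics.QuantumManyBody.BoseGas
open Summit.AtomisticToContinuum.BoseEinsteinCondensation.Theses
open Summit.AtomisticToContinuum.BoseEinsteinCondensation.Theses.BECInsertionCorrector
open Summit.AtomisticToContinuum.BoseEinsteinCondensation.Theorems.StaticResponseBound.Negative
open Summit.AtomisticToContinuum.BoseEinsteinCondensation.Cruxes.StaticResponseBound.UvThomsonForceWave

/-- `E₀(v, 1, L) = 0` in real form: one particle has no pair interaction and the constant state has zero
kinetic energy. [folklore] -/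
theorem toReal_periodicGroundStateEnergy_one {L : ℝ} (hL : 0 < L) (v : ℝ → ℝ≥0∞) :
    (periodicGroundStateEnergy v 1 L).toReal = 0 := by
  have h := periodicGroundStateEnergy_le v (PeriodicTrialState.const hL)
  rw [periodicEnergy_const hL v, nonpos_iff_eq_zero] at h
  rw [h, ENNReal.toReal_zero]

/-- **Outside the linear-response window the crux's inequality is free.**  At `L = (N/ρ)^{1/3}`, `N ≥ 1`, `k ≠ 0`:
if `ε²·ρa·max(ρa,|p|²) < t²` then `Ineq v C ρ N k t Ψ` holds with `C = max(1/ε, 1 + K/ε²)`, given the dilute upper bound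
`E₀(v,N,L) ≤ KρaN` (used for `N ≥ 2`). [folklore] -/
theorem ineq_of_strong_coupling {v : ℝ → ℝ≥0∞} {ε K ρ : ℝ} (hε : 0 < ε) (hK : 0 < K) (hρ : 0 < ρ) {N : ℕ}
    (hN : 0 < N)
    (hE : 2 ≤ N → (periodicGroundStateEnergy v N (sideLength ρ N)).toReal ≤
      K * ρ * (scatteringLength v).toReal * N)
    {k : Fin 3 → ℤ} (hk : k ≠ 0) {t : ℝ}
    (ht : ε ^ 2 * (ρ * (scatteringLength v).toReal) *
        max (ρ * (scatteringLength v).toReal) (psq (sideLength ρ N) k) < t ^ 2)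
    (Ψ : PeriodicTrialState N (sideLength ρ N)) (hΨ : periodicEnergy v Ψ ≠ ⊤) :
    Ineq v (max (1 / ε) (1 + K / ε ^ 2)) ρ N k t Ψ := by
  have hL : 0 < sideLength ρ N := sideLength_pos hρ hN
  have hP : 0 < psq (sideLength ρ N) k := freeSq_psq_pos hL hk
  have ha : 0 ≤ ρ * (scatteringLength v).toReal := mul_nonneg hρ.le ENNReal.toReal_nonneg
  have hm : 0 < max (ρ * (scatteringLength v).toReal) (psq (sideLength ρ N) k) :=
    lt_of_lt_of_le hP (le_max_right _ _)
  rcases le_total (psq (sideLength ρ N) k) (ρ * (scatteringLength v).toReal) with hIR | hUV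
  · -- infrared branch: `max = ρa`, `|t| > ερa`, trivial floor with `C = 1/ε`
    have hmeq : max (ρ * (scatteringLength v).toReal) (psq (sideLength ρ N) k) =
        ρ * (scatteringLength v).toReal := max_eq_left hIR
    rw [hmeq] at ht hm
    have ht' : (ε * (ρ * (scatteringLength v).toReal)) ^ 2 < |t| ^ 2 := by
      rw [sq_abs]
      calc (ε * (ρ * (scatteringLength v).toReal)) ^ 2
          = ε ^ 2 * (ρ * (scatteringLength v).toReal) * (ρ * (scatteringLength v).toReal) := by ring
        _ < t ^ 2 := ht
    have habs : ε * (ρ * (scatteringLength v).toReal) < |t| :=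
      lt_of_pow_lt_pow_left₀ 2 (abs_nonneg t) ht'
    refine ineq_mono_const (C := 1 / ε) ?_ (le_max_left _ _)
    refine ineq_of_large_t v (by positivity) ρ k Ψ hΨ (by rw [hmeq]; exact hm) ?_
    rw [hmeq, div_le_iff₀ (one_div_pos.mpr hε), mul_one_div, le_div_iff₀ hε]
    linarith
  · -- ultraviolet branch: `max = |p|²`, free square and the dilute upper bound with `C = 1 + K/ε²`
    have hmeq : max (ρ * (scatteringLength v).toReal) (psq (sideLength ρ N) k) = psq (sideLength ρ N) k :=
      max_eq_right hUV
    refine ineq_mono_const (C := 1 + K / ε ^ 2) ?_ (le_max_right _ _)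
    have hfree := stub_freeSquare v N (sideLength ρ N) hL k hk t Ψ hΨ
    unfold Ineq
    rw [hmeq]
    rw [hmeq] at ht
    -- `E₀ ≤ (K/ε²) t² N/|p|²`
    have hE0 : (periodicGroundStateEnergy v N (sideLength ρ N)).toReal ≤
        K / ε ^ 2 * t ^ 2 * N / psq (sideLength ρ N) k := by
      rcases Nat.lt_or_ge N 2 with h1 | h2
      · -- `N = 1`
        obtain rfl : N = 1 := by omega
        rw [toReal_periodicGroundStateEnergy_one hL v]
        positivity
      · refine (hE h2).trans ?_
        rw [le_div_iff₀ hP]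
        -- `K ρ a N |p|² ≤ (K/ε²) t² N`
        have h3 : (ρ * (scatteringLength v).toReal) * psq (sideLength ρ N) k ≤ t ^ 2 / ε ^ 2 := by
          rw [le_div_iff₀ (by positivity)]
          nlinarith
        calc K * ρ * (scatteringLength v).toReal * N * psq (sideLength ρ N) k
            = K * N * ((ρ * (scatteringLength v).toReal) * psq (sideLength ρ N) k) := by ring
          _ ≤ K * N * (t ^ 2 / ε ^ 2) := mul_le_mul_of_nonneg_left h3 (by positivity)
          _ = K / ε ^ 2 * t ^ 2 * N := by ring
    have e : (1 + K / ε ^ 2) * t ^ 2 * N / psq (sideLength ρ N) k =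
        (N : ℝ) * t ^ 2 / psq (sideLength ρ N) k + K / ε ^ 2 * t ^ 2 * N / psq (sideLength ρ N) k := by
      ring
    rw [e]
    linarith

/-- **`LargeNHalf ⟸ CoreWeak ε` for every `ε > 0`: the many-body half of the crux is its linear-response-window content.**
Hypotheses: `ε > 0`; the dilute upper bound along `L = (N/ρ)^{1/3}` (`E₀ ≤ KρaN`, `N ≥ 2`, text of
`exists_groundStateEnergy_toReal_le`); `CoreWeak ε` = the crux restricted to `N⁸ρa³ > c` and `t² ≤ ε²ρa·max(ρa,|p|²)`
(every `c > 0`).  Conclusion: the text of `LargeNHalf`. [folklore] -/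
theorem largeNHalf_of_coreWeak' {ε : ℝ} (hε : 0 < ε)
    (hK : ∀ v : ℝ → ℝ≥0∞, IsRepulsiveFiniteRange v →
      ∃ ρ₀ : ℝ, 0 < ρ₀ ∧ ∃ K : ℝ, 0 < K ∧ ∀ ρ : ℝ, 0 < ρ → ρ < ρ₀ → ∀ N : ℕ, 2 ≤ N →
        (periodicGroundStateEnergy v N (sideLength ρ N)).toReal ≤
          K * ρ * (scatteringLength v).toReal * N)
    (hcore : ∀ v : ℝ → ℝ≥0∞, IsRepulsiveFiniteRange v → ∀ c : ℝ, 0 < c →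
      ∃ ρ₀ : ℝ, 0 < ρ₀ ∧ ∃ C : ℝ, 0 < C ∧
        ∀ ρ : ℝ, 0 < ρ → ρ < ρ₀ → ∀ N : ℕ,
          c < (N : ℝ) ^ 8 * (ρ * (scatteringLength v).toReal ^ 3) →
          ∀ k : Fin 3 → ℤ, k ≠ 0 → ∀ t : ℝ,
            t ^ 2 ≤ ε ^ 2 * (ρ * (scatteringLength v).toReal) *
              max (ρ * (scatteringLength v).toReal) (psq (sideLength ρ N) k) →
            ∀ Ψ : PeriodicTrialState N (sideLength ρ N), periodicEnergy v Ψ ≠ ⊤ → Ineq v C ρ N k t Ψ) :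
    ∀ v : ℝ → ℝ≥0∞, IsRepulsiveFiniteRange v → ∀ c : ℝ, 0 < c →
      ∃ ρ₀ : ℝ, 0 < ρ₀ ∧ ∃ C : ℝ, 0 < C ∧
        ∀ ρ : ℝ, 0 < ρ → ρ < ρ₀ → ∀ N : ℕ,
          c < (N : ℝ) ^ 8 * (ρ * (scatteringLength v).toReal ^ 3) →
          ∀ k : Fin 3 → ℤ, k ≠ 0 → ∀ t : ℝ, ∀ Ψ : PeriodicTrialState N (sideLength ρ N),
            periodicEnergy v Ψ ≠ ⊤ → Ineq v C ρ N k t Ψ := by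
  intro v hv c hc
  obtain ⟨ρ₁, hρ₁, C₁, hC₁, hweak⟩ := hcore v hv c hc
  obtain ⟨ρ₂, hρ₂, K, hK0, hdil⟩ := hK v hv
  refine ⟨min ρ₁ ρ₂, lt_min hρ₁ hρ₂, max C₁ (max (1 / ε) (1 + K / ε ^ 2)),
    lt_of_lt_of_le hC₁ (le_max_left _ _), ?_⟩
  intro ρ hρ hρlt N hN8 k hk t Ψ hΨ
  rcases Nat.eq_zero_or_pos N with hN | hN
  · subst hN
    exact ineq_N_zero v _ ρ k t Ψ hΨ
  · by_cases hwin : t ^ 2 ≤ ε ^ 2 * (ρ * (scatteringLength v).toReal) *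
        max (ρ * (scatteringLength v).toReal) (psq (sideLength ρ N) k)
    · exact ineq_mono_const (hweak ρ hρ (lt_of_lt_of_le hρlt (min_le_left _ _)) N hN8 k hk t hwin Ψ hΨ)
        (le_max_left _ _)
    · push Not at hwin
      have hE : 2 ≤ N → (periodicGroundStateEnergy v N (sideLength ρ N)).toReal ≤
          K * ρ * (scatteringLength v).toReal * N :=
        fun h2 => hdil ρ hρ (lt_of_lt_of_le hρlt (min_le_right _ _)) N h2
      exact ineq_mono_const (ineq_of_strong_coupling hε hK0 hρ hN hE hk hwin Ψ hΨ) (le_max_right _ _)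

/-- **Registered form `largeNHalf_of_coreWeak`** (closed statement of `largeNHalf_of_coreWeak'`). [folklore] -/
theorem largeNHalf_of_coreWeak :
    ∀ {ε : ℝ}, 0 < ε →
    (∀ v : ℝ → ℝ≥0∞, IsRepulsiveFiniteRange v →
    ∃ ρ₀ : ℝ, 0 < ρ₀ ∧ ∃ K : ℝ, 0 < K ∧ ∀ ρ : ℝ, 0 < ρ → ρ < ρ₀ → ∀ N : ℕ, 2 ≤ N →
      (periodicGroundStateEnergy v N (sideLength ρ N)).toReal ≤
        K * ρ * (scatteringLength v).toReal * N) →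
    (∀ v : ℝ → ℝ≥0∞, IsRepulsiveFiniteRange v → ∀ c : ℝ, 0 < c →
    ∃ ρ₀ : ℝ, 0 < ρ₀ ∧ ∃ C : ℝ, 0 < C ∧
      ∀ ρ : ℝ, 0 < ρ → ρ < ρ₀ → ∀ N : ℕ,
        c < (N : ℝ) ^ 8 * (ρ * (scatteringLength v).toReal ^ 3) →
        ∀ k : Fin 3 → ℤ, k ≠ 0 → ∀ t : ℝ,
          t ^ 2 ≤ ε ^ 2 * (ρ * (scatteringLength v).toReal) *
            max (ρ * (scatteringLength v).toReal) (psq (sideLength ρ N) k) →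
          ∀ Ψ : PeriodicTrialState N (sideLength ρ N), periodicEnergy v Ψ ≠ ⊤ → Ineq v C ρ N k t Ψ) →
    ∀ v : ℝ → ℝ≥0∞, IsRepulsiveFiniteRange v → ∀ c : ℝ, 0 < c →
      ∃ ρ₀ : ℝ, 0 < ρ₀ ∧ ∃ C : ℝ, 0 < C ∧
        ∀ ρ : ℝ, 0 < ρ → ρ < ρ₀ → ∀ N : ℕ,
          c < (N : ℝ) ^ 8 * (ρ * (scatteringLength v).toReal ^ 3) →
          ∀ k : Fin 3 → ℤ, k ≠ 0 → ∀ t : ℝ, ∀ Ψ : PeriodicTrialState N (sideLength ρ N),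
            periodicEnergy v Ψ ≠ ⊤ → Ineq v C ρ N k t Ψ :=
  fun hε hK hcore => largeNHalf_of_coreWeak' hε hK hcore

/-- Conversely the crux's many-body half implies its linear-response-window restriction (drop the hypothesis).
[folklore] -/
theorem coreWeak_of_largeNHalf (ε : ℝ)
    (h : ∀ v : ℝ → ℝ≥0∞, IsRepulsiveFiniteRange v → ∀ c : ℝ, 0 < c →
      ∃ ρ₀ : ℝ, 0 < ρ₀ ∧ ∃ C : ℝ, 0 < C ∧
        ∀ ρ : ℝ, 0 < ρ → ρ < ρ₀ → ∀ N : ℕ,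
          c < (N : ℝ) ^ 8 * (ρ * (scatteringLength v).toReal ^ 3) →
          ∀ k : Fin 3 → ℤ, k ≠ 0 → ∀ t : ℝ, ∀ Ψ : PeriodicTrialState N (sideLength ρ N),
            periodicEnergy v Ψ ≠ ⊤ → Ineq v C ρ N k t Ψ) :
    ∀ v : ℝ → ℝ≥0∞, IsRepulsiveFiniteRange v → ∀ c : ℝ, 0 < c →
      ∃ ρ₀ : ℝ, 0 < ρ₀ ∧ ∃ C : ℝ, 0 < C ∧
        ∀ ρ : ℝ, 0 < ρ → ρ < ρ₀ → ∀ N : ℕ,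
          c < (N : ℝ) ^ 8 * (ρ * (scatteringLength v).toReal ^ 3) →
          ∀ k : Fin 3 → ℤ, k ≠ 0 → ∀ t : ℝ,
            t ^ 2 ≤ ε ^ 2 * (ρ * (scatteringLength v).toReal) *
              max (ρ * (scatteringLength v).toReal) (psq (sideLength ρ N) k) →
            ∀ Ψ : PeriodicTrialState N (sideLength ρ N), periodicEnergy v Ψ ≠ ⊤ → Ineq v C ρ N k t Ψ := by
  intro v hv c hc
  obtain ⟨ρ₀, hρ₀, C, hC, hbody⟩ := h v hv c hc
  exact ⟨ρ₀, hρ₀, C, hC, fun ρ hρ hρlt N hN8 k hk t _ Ψ hΨ => hbody ρ hρ hρlt N hN8 k hk t Ψ hΨ⟩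

end Summit.AtomisticToContinuum.BoseEinsteinCondensation.Cruxes.StaticResponseBound.FewBody

end
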